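import Literature.IUT.LogThetaLattice.GlobalLGPFrobenioidsRealifiedCanonical
import Literature.AlgebraicGeometry.Frobenioids.Cor54SubBiratCompatProofs
import Literature.AlgebraicGeometry.Frobenioids.PreFrobenioidEquivalenceTransport
import HarnessLib

/-!
# [IUTchIII] Proposition 3.7 (ii) «(†𝓕⊛ℝ_𝔪𝔬𝔡)_α», G: `Φ^birat` of `(†𝓕⊛_𝔪𝔬𝔡)_α` along the comparison
# equivalence; THE canonical realification of `(†𝓕⊛_𝔪𝔬𝔡)_α = Ffrak F` ITSELF is `Prop37.FrakRlfCat F`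

abc-iut cell, layer L6, wave-5 seat abc-iut-w5-d153 (gen 2); part G of the lineage (A RatFn / B Model / C Frobenioid /
D Primes / E DataHom / F Canonical), removing the one presentation step left open in part F's header.

PRINT. [FrdI] Prop. 4.4 (iii) p. 83 ("a unique subfunctor of groups `Φ^birat ⊆ Φ^gp`"), Cor. 5.4 p. 104 ("follows
immediately from Corollaries 4.10; 4.11, (iii), (iv)": along an equivalence of Frobenioids `Φ₁^birat` is
carried onto `Φ₂^birat`), Prop. 5.3 p. 103 (`C^rlf`) [cite: MochizukiFrdI2008, Cor. 5.4 p.104]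
[cite: MochizukiFrdI2008, Prop. 5.3 p.103]; [IUTchIII] Ex. 3.6 (ii) / Prop. 3.7 (ii) [claim key Mochizuki2012, status
disputed (D-0012)].

CONTENTS (ns `Literature.IUT.LogThetaLattice.Prop37.FrakRlfCat`). Part F identified layer L1's canonical `C^rlf`
of the [FrdI] Thm. 5.2 MODEL `FrakModel (Prop37.modelHyps F)` with `FrakRlfCat F`; the Frobenioid structure of
`(†𝓕⊛_𝔪𝔬𝔡)_α = Ffrak F` itself is `structureFunctor = toModel ⋙ toElem` (abc-iut-L6-t6/w4-d005), so its
`C^rlf` (`PreFrobenioid.realification (structureFunctor _) (Rcan F)`) is built from L1's concrete `Φ^birat` of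
`toModel ⋙ toElem`, not of `toElem`. Here:
* `idDivisorIso`, `biratCompat` — abc-iut-w5-d221's C54/L03 closer `FrdI.Cor54Sub.biratCompat_of` ([FrdI]
  Cor. 5.4, `Φ^birat`-part) instantiated at the comparison equivalence `toModel : Ffrak F ≌ FrakModel` over
  `𝟭 𝒟` with the identity isomorphism of divisor monoids (pre-steps correspond definitionally; every morphism
  of a model Frobenioid with group-like `𝔹` is co-angular, abc-iut-found's `ModelFrobenioid.isCoAngular`;
  transport of co-angularity along an equivalence, abc-iut-L1's `isCoAngular_equivalence_iff`);
* **`biratSubfunctor_structureFunctor_eq : biratSubfunctor (structureFunctor _) = biratSubfunctor (toElem _ _ _)`**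
  (`= Φ^birat = Div(F^×_mod)`);
* **`realification_structureFunctor_eq : PreFrobenioid.realification (structureFunctor (Prop37.modelHyps F))
  (Rcan F) = CanonicalRlf F`** (equality of types) and **`nonempty_realification_structureFunctor_equiv`**:
  THE canonical realification ([FrdI] Prop. 5.3 at `RealificationData.canonical`) of `(†𝓕⊛_𝔪𝔬𝔡)_α = Ffrak F`
  ITSELF is equivalent to `Prop37.FrakRlfCat F` — junction J1 of the lineage with no presentation step left.
No `Prop`-valued definition; nothing here asserts a disputed claim or takes a side on [IUTchIII] Cor. 3.12;
typed ≠ discharged; instantiated ≠ endorsed.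
-/

noncomputable section

namespace Literature.IUT.LogThetaLattice

namespace Prop37

namespace FrakRlfCat

open CategoryTheory Opposite NumberField GlobalFrobenioidModels Literature.AlgebraicGeometry.Frobenioids
open Literature.AlgebraicGeometry.Frobenioids (Places)

variable (F : Type) [Field F] [NumberField F]

/-! ### The comparison equivalence `Ffrak F ≌ FrakModel` as data for [FrdI] Cor. 5.4's `Φ^birat`-transport -/

/-- The [FrdI] operations of `(†𝓕⊛_𝔪𝔬𝔡)_α = Ffrak F` (structure functor `toModel ⋙ toElem`).
[cite: MochizukiFrdI2008, Def. 1.1 (iv) p.19] -/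
abbrev SFrak : PreFrobenioidData (Ffrak F) Base.{0} :=
  PreFrobenioidData.ofFunctor (Φmod (Places F) (Gamma F) (nonneg F))
    (GlobalFrobenioidModels.structureFunctor (Prop37.modelHyps F))

/-- The [FrdI] operations of the Thm. 5.2 model `FrakModel (Prop37.modelHyps F)` (structure functor `toElem`).
[cite: MochizukiFrdI2008, Thm. 5.2 (i) p.100] -/
abbrev SModel : PreFrobenioidData (FrakModel (Prop37.modelHyps F)) Base.{0} :=
  PreFrobenioidData.ofFunctor (Φmod (Places F) (Gamma F) (nonneg F))
    (ModelFrobenioid.toElem (Φmod (Places F) (Gamma F) (nonneg F)) (Bmod F) (divBmod (Prop37.modelHyps F)))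

/-- The identity isomorphism of divisor monoids `Φ ⥲ Φ` over `𝟭 𝒟` between the operations of `Ffrak F` and
of its model (abc-iut-L1-t3's `DivisorMonoidIsoOverBase`, the `Ψ^Φ` of [FrdI] Cor. 4.11 (iii) — tautological
here, the two structures share `Φmod`). [cite: MochizukiFrdI2008, Cor. 4.11 (iii) p.92] -/
def idDivisorIso : PreFrobenioidData.DivisorMonoidIsoOverBase (SFrak F) (SModel F) (𝟭 Base.{0}) where
  iso _ := MulEquiv.refl _
  natural _ _ _ _ := rfl

/-- `Base₂ ∘ toModel ≅ 𝟭 ∘ Base₁` — on the nose (`structureFunctor = toModel ⋙ toElem`).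
[cite: MochizukiFrdI2008, Cor. 4.11 (ii) p.92] -/
def baseIso :
    (GlobalFrobenioidModels.toModel (Prop37.modelHyps F)).asEquivalence.functor ⋙ (SModel F).base ≅
      (SFrak F).base ⋙ 𝟭 Base.{0} :=
  Iso.refl _

/-- The structure functor `toElem` of the model is a pre-Frobenioid ([FrdI] Thm. 5.2 (ii); abc-iut-found).
[cite: MochizukiFrdI2008, Thm. 5.2 (ii) p.101] -/
theorem isPreFrobenioid_toElem :
    IsPreFrobenioid (Φmod (Places F) (Gamma F) (nonneg F))
      (ModelFrobenioid.toElem (Φmod (Places F) (Gamma F) (nonneg F)) (Bmod F) (divBmod (Prop37.modelHyps F))) :=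
  (ModelFrobenioid.isFrobenioid (isMonoidOn_constMonoidOn _) (objectwise_isDivisorial_Φmod (Prop37.modelHyps F))
    (isMonoidOn_constMonoidOn _) objectwise_isGroupLike_Bmod isGraphConnected_base
    isTotallyEpimorphic_base).isPreFrobenioid

/-- A pre-step of the model conjugated by the counit isomorphisms of the comparison equivalence is a pre-step (for
the transport along `toModel⁻¹`). [cite: MochizukiFrdI2008, Def. 1.2 (iii) p.22] -/
theorem isPreStep_fun_inv_map {X Y : FrakModel (Prop37.modelHyps F)} (δ : X ⟶ Y)
    (h : PreFrobenioid.IsPreStep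
      (ModelFrobenioid.toElem (Φmod (Places F) (Gamma F) (nonneg F)) (Bmod F) (divBmod (Prop37.modelHyps F))) δ) :
    PreFrobenioid.IsPreStep
      (ModelFrobenioid.toElem (Φmod (Places F) (Gamma F) (nonneg F)) (Bmod F) (divBmod (Prop37.modelHyps F)))
      ((GlobalFrobenioidModels.toModel (Prop37.modelHyps F)).map
        ((GlobalFrobenioidModels.toModel (Prop37.modelHyps F)).asEquivalence.inverse.map δ)) := by
  have hmap : (GlobalFrobenioidModels.toModel (Prop37.modelHyps F)).map
        ((GlobalFrobenioidModels.toModel (Prop37.modelHyps F)).asEquivalence.inverse.map δ) =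
      ((GlobalFrobenioidModels.toModel (Prop37.modelHyps F)).asEquivalence.counitIso.app X).hom ≫ δ ≫
        ((GlobalFrobenioidModels.toModel (Prop37.modelHyps F)).asEquivalence.counitIso.app Y).inv :=
    (GlobalFrobenioidModels.toModel (Prop37.modelHyps F)).asEquivalence.fun_inv_map X Y δ
  rw [hmap]
  exact PreFrobenioid.IsPreStep.comp _ (PreFrobenioid.isPreStep_of_isIso _ _)
    (PreFrobenioid.IsPreStep.comp _ h (PreFrobenioid.isPreStep_of_isIso _ _))

/-- **[FrdI] Cor. 5.4, `Φ^birat`-part, at the comparison equivalence `Ffrak F ≌ FrakModel`** (abc-iut-w5-d221's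
`biratCompat_of`): the concrete `Φ^birat` of `(†𝓕⊛_𝔪𝔬𝔡)_α` is carried (by the identity of `Φ`) onto that of
its model. Inputs: pre-steps correspond definitionally (`structureFunctor = toModel ⋙ toElem`); every morphism
of the model is co-angular (abc-iut-found's `ModelFrobenioid.isCoAngular`, `𝔹 = F^×` group-like), transported
to `Ffrak F` by abc-iut-L1's `isCoAngular_equivalence_iff`. [cite: MochizukiFrdI2008, Cor. 5.4 p.104] -/
theorem biratCompat :
    FrdI.Cor54Sub.BiratCompat (GlobalFrobenioidModels.structureFunctor (Prop37.modelHyps F))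
      (ModelFrobenioid.toElem (Φmod (Places F) (Gamma F) (nonneg F)) (Bmod F) (divBmod (Prop37.modelHyps F)))
      (𝟭 Base.{0}) (idDivisorIso F) :=
  FrdI.Cor54Sub.biratCompat_of _ _ (GlobalFrobenioidModels.toModel (Prop37.modelHyps F)).asEquivalence
    (isPreFrobenioid_toElem F) (𝟭 Base.{0}) (idDivisorIso F) (baseIso F)
    (fun _ _ _ => rfl)
    (fun _ _ _ h => h)
    (fun _ _ _ h => ⟨(PreFrobenioidData.ofFunctor_isCoAngular _ _).mpr
      (ModelFrobenioid.isCoAngular objectwise_isGroupLike_Bmod _), h.2⟩)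
    (fun _ _ δ h => isPreStep_fun_inv_map F δ h)
    (fun _ _ δ h => ⟨(PreFrobenioidData.ofFunctor_isCoAngular _ _).mpr
      ((PreFrobenioid.isCoAngular_equivalence_iff (GlobalFrobenioidModels.toModel (Prop37.modelHyps F)).asEquivalence
        (isPreFrobenioid_toElem F) _).mpr (ModelFrobenioid.isCoAngular objectwise_isGroupLike_Bmod _)),
      isPreStep_fun_inv_map F δ h.2⟩)

/-! ### `Φ^birat` and `C^rlf` of `(†𝓕⊛_𝔪𝔬𝔡)_α = Ffrak F` itself -/

/-- **`Φ^birat` of `(†𝓕⊛_𝔪𝔬𝔡)_α` (structure functor `toModel ⋙ toElem`) IS `Φ^birat` of its model (structure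
functor `toElem`)** `= Div(F^×_mod)`, objectwise. [cite: MochizukiFrdI2008, Cor. 5.4 p.104] -/
theorem biratSubfunctor_structureFunctor_carrier (X : Base.{0}) :
    (PreFrobenioid.biratSubfunctor (GlobalFrobenioidModels.structureFunctor (Prop37.modelHyps F))).carrier X =
      (PsiBirat F).carrier X := by
  have h : ((PreFrobenioid.biratSubfunctor
      (GlobalFrobenioidModels.structureFunctor (Prop37.modelHyps F))).carrier X).map
        (MonGp.map ((idDivisorIso F).iso X).toMonoidHom) = (PsiBirat F).carrier X := biratCompat F X
  have hid : ∀ x : Algebra.GrothendieckGroup (EffDiv (Places F) (Gamma F) (nonneg F)),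
      MonGp.map ((idDivisorIso F).iso X).toMonoidHom x = x := fun x => DFunLike.congr_fun MonGp.map_id x
  ext c
  rw [← h]
  constructor
  · exact fun hc => Subgroup.mem_map.mpr ⟨c, hc, hid c⟩
  · intro hc
    obtain ⟨y, hy, hyc⟩ := Subgroup.mem_map.mp hc
    have hcy : c = y := hyc.symm.trans (hid y)
    subst hcy
    exact hy

/-- **`Φ^birat(Ffrak F) = Φ^birat(FrakModel)`** as subfunctors of groups of `Φ^gp`.
[cite: MochizukiFrdI2008, Cor. 5.4 p.104] -/
theorem biratSubfunctor_structureFunctor_eq :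
    PreFrobenioid.biratSubfunctor (GlobalFrobenioidModels.structureFunctor (Prop37.modelHyps F)) = PsiBirat F :=
  GpSubfunctor.ext_carrier (funext (biratSubfunctor_structureFunctor_carrier F))

/-- `Φ^birat(∗)` of `(†𝓕⊛_𝔪𝔬𝔡)_α` consists of the principal classes `Div(f)`, `f ∈ F^×_mod`.
[cite: MochizukiFrdI2008, Thm. 5.2 (ii) p.101] -/
theorem mem_biratSubfunctor_structureFunctor_iff
    (c : Algebra.GrothendieckGroup (EffDiv (Places F) (Gamma F) (nonneg F))) :
    c ∈ (PreFrobenioid.biratSubfunctor (GlobalFrobenioidModels.structureFunctor (Prop37.modelHyps F))).carrier pt ↔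
      ∃ f : Fˣ, divBHom (Prop37.modelHyps F) f = c := by
  rw [biratSubfunctor_structureFunctor_carrier]
  exact mem_psiBirat_iff F c

/-- **`C^rlf(Ffrak F) = C^rlf(FrakModel)`**: THE canonical realification ([FrdI] Prop. 5.3 at
`RealificationData.canonical`) of `(†𝓕⊛_𝔪𝔬𝔡)_α = Ffrak F` ITSELF is, as a type (and category), part F's
`CanonicalRlf F` — both are the model Frobenioid of `(Φ(∗)^rlf, ℝ · Φ^birat)` with the SAME `Φ^birat`.
[cite: MochizukiFrdI2008, Prop. 5.3 p.103] -/
theorem realification_structureFunctor_eq :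
    PreFrobenioid.realification (GlobalFrobenioidModels.structureFunctor (Prop37.modelHyps F)) (Rcan F) =
      CanonicalRlf F := by
  show (Rcan F).RlfModelOf
      (PreFrobenioid.biratSubfunctor (GlobalFrobenioidModels.structureFunctor (Prop37.modelHyps F))) =
    (Rcan F).RlfModelOf (PsiBirat F)
  rw [biratSubfunctor_structureFunctor_eq]

/-- **J1 with no presentation step left — `C^rlf((†𝓕⊛_𝔪𝔬𝔡)_α) ≌ (†𝓕⊛ℝ_𝔪𝔬𝔡)_α`**: THE canonical
realification of `Ffrak F` (layer L1's `PreFrobenioid.realification (structureFunctor _)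
(RealificationData.canonical Φmod _)`) is equivalent to `Prop37.FrakRlfCat F` (part F's
`canonicalRealificationEquiv` transported along `realification_structureFunctor_eq`).
[cite: MochizukiFrdI2008, Prop. 5.3 p.103] -/
theorem nonempty_realification_structureFunctor_equiv :
    Nonempty (PreFrobenioid.realification (GlobalFrobenioidModels.structureFunctor (Prop37.modelHyps F)) (Rcan F) ≌
      FrakRlfCat F) := by
  show Nonempty ((Rcan F).RlfModelOf
      (PreFrobenioid.biratSubfunctor (GlobalFrobenioidModels.structureFunctor (Prop37.modelHyps F))) ≌
    FrakRlfCat F)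
  rw [biratSubfunctor_structureFunctor_eq]
  exact ⟨canonicalRealificationEquiv F⟩

end FrakRlfCat

end Prop37

end Literature.IUT.LogThetaLattice

end
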